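import Summits.BirchSwinnertonDyer.BirchSwinnertonDyer.Theorems.ByReductionTypeAtTwoRankOneAtTwoOneDoorLawCDefs
import HarnessLib

/-!
# Route ByReductionTypeAtTwo, crux `RankOneAtTwoBigImageOddLocal` (stmt-BirchSwinnertonDyer-23715), LINE v8.7 `one_door_analytic`:
# the BOTTOM RUNG of the Euler-system half — `DoorIndexLawUpperCAtTwoBottomNeg` (U₀⁻) and its complement

Lead prover seat `bsd-line-fkl-p1` g11 (2026-08-28).  Companion of `…OneDoorLawCDefs.lean` (APPEND #6: the two halves
`DoorIndexLawUpperCAtTwo` / `DoorIndexLawLowerCAtTwo` of the one-door law AN-28c), as a separate module so that the statements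
files stay under the size limit.  Statements + import-free bookkeeping only; nothing is asserted; BSD is not proved by any of this.

Why.  After gens 8–10 the Euler-system half U = `DoorIndexLawUpperCAtTwo` (Kolyvagin's upper bound on `Ш(W)[2^∞]·Ш(Wd)[2^∞]` by
the `2`-part of the Heegner index, exact power of `2`) is wired BY NAME to route GenusKolyvaginAtTwo's registered K-side stub
`stub_upperBoundAtTwo` of item 22137 (`Theorems/…OneDoorHalvesOfGenusStubs.lean`), whose own line needs Kolyvagin's RELATION at
`2` (item 24880, L) AND the `R_M`-linear structure theorem at `2` (item 24882, XL).  The lead report G10 §3 isolated the one corner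
of U that needs NEITHER the structure theorem NOR any `±`-eigenspace: at a MINIMAL door of a curve with `Δ_W < 0` (exactly one
prime `q₀ ∣ d_K` with `#Ẽ(𝔽_{q₀})` even, i.e. `t = 1`, `s = 0`; `t` is odd at `Δ_W < 0` by `transpCount_mod_two_of_doorAdmissible`)
and an odd-constant datum, `y_K ∉ 2E(K)` (`m = 0`) forces `Ш(W)[2] = 0 ∧ Ш(Wd)[2] = 0` by Kolyvagin's FIRST `2`-descent run OVER
`ℚ` (`E` and `E^K` have the same `2`-torsion module; their Selmer groups live in one `H¹(ℚ, E[2])` with local conditions that agree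
off `q₀` and are one line each at `q₀`) plus Cassels–Tate parity for the twin.  The abstract engine of that descent — Gross 1991 §10
at `p = 2`, eigenspace-free — is the kernel theorem file `Theorems/…OneDoorFirstDescentAtTwo.lean` (this generation):
`res_errorPlace_ne_zero_of_relaxed`, `eq_zero_or_eq_heegner_of_mem_sel` (`Sel₂(E/ℚ) = {0, δy}`), `twinSel_eq_bot`
(`Sel₂(E^K/ℚ) = 0`).  This file states that corner in the door currency of AN-28c — VERBATIM the binders of
`DoorIndexLawUpperCAtTwo`, the exponent specialised to `m = 0`, and four extra hypotheses `W.Δ < 0`, `t = 1`, `s = 0`, `Odd Dt.c` —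
so that the skeleton v8.7 can carry U as TWO registered stubs, `stub_doorUpperBottomNeg` (THEOREM-GRADE on paper: its leaves are
Gross's Props. 6.2 (1)(2) at `2` for the first layer — the `M = 2` face of item 24880 —, Poitou–Tate and local Tate duality for
`E[2]` over `ℚ`, Čebotarev at `M = 2`, Mazur–Rubin 2010 Lemmas 2.2/2.10, Cassels–Tate parity, Gross–Zagier–Kolyvagin ranks) and
`stub_doorUpperOffBottomNeg` (the honest residue: `Δ_W > 0`, non-minimal doors, `m ≥ 1`, even constants — conjecture-grade),
losslessly (`doorIndexLawUpperCAtTwo_iff_bottomNeg_and_offBottomNeg`).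

References (locators): Gross 1991 §§2, 6, 8–10 (Props. 2.1, 2.3, 6.2, 8.2, §10); McCallum 1991 Cor. 3.2, Prop. 4.4; Mazur–Rubin 2010
Lemmas 2.2, 2.9–2.11, Def. 3.1, Prop. 3.3; Kramer 1981 Thm. 1, Prop. 3; Kolyvagin 1990 Thm. A and Cor. 13 (error term `d` at `p = 2`,
cf. Matar–Nekovář 2019 §0.2).
-/

set_option autoImplicit false

noncomputable section

open scoped Classical

set_option linter.dupNamespace false

namespace Summit.BirchSwinnertonDyer.BirchSwinnertonDyer.Theorems.RankOneAtTwoOneDoor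

open Literature.NumberTheory.EllipticCurves Literature.NumberTheory.EllipticCurves.ModularForms
  Summit.BirchSwinnertonDyer.Rank1Residual.F1Sign2
  Summit.BirchSwinnertonDyer.Rank1Residual.F1Sign2.TranspositionDoor

/-! ### APPEND #7 (lead prover seat `bsd-line-fkl-p1` g11, 2026-08-28) — LINE v8.7: the BOTTOM RUNG U₀⁻ of the Euler-system half -/

/-- **U₀⁻ `DoorIndexLawUpperCAtTwoBottomNeg` — the BOTTOM RUNG of the Euler-system half at NEGATIVE discriminant (THEOREM-CANDIDATE;
tagged `conjecture` only because it is unproved in the tree).**  Binders VERBATIM as in `DoorIndexLawUpperCAtTwo` (`W` globally minimal,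
non-CM, `ρ_{W,2^n}` onto for all `n`, odd torsion, odd Tamagawa product, analytic rank one; `K` imaginary quadratic with `d_K`
door-admissible and `L(W^{(d_K)},1) ≠ 0`; a parametrisation datum `Dt` of level `N_W` with `P ∈ E(K)` mapping to its complex Heegner
point; `Wd` a globally minimal model of `W^{(d_K)}`), the exponent specialised to `m = 0`, and FOUR extra hypotheses: `Δ_W < 0`, the
door is MINIMAL (`t = 1`, `s = 0`: exactly one prime of `d_K` at which the `2`-division cubic acquires a root), and `Dt.c` is odd.
THEN: if `P ∉ 2E(K) + E(K)_tors` (`HasTwoDivisibilityUpToTorsion W K P 0`), the `Ш`-side of AN-28c is at most `2·0 + [Δ_W < 0] = 1`,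
i.e. (`bottomNeg_conclusion_iff`) `ord₂ #Ш(W)[2^∞] = 0 ∧ ord₂ #Ш(Wd)[2^∞] = 0`.  Proof ON PAPER (lead reports G10 §3, G11 §2; kernel
engine `Theorems/…OneDoorFirstDescentAtTwo.lean`): Kolyvagin's first `2`-descent over `ℚ` with the single error place `q₀` —
`Sel₂(W/ℚ) = {0, δ(T·y_K)}` and `Sel₂(Wd/ℚ) = 0` — from Gross's Prop. 6.2 at `2` for the first layer, Poitou–Tate, the perfect pairing
of the lines `H¹_ur(ℚ_ℓ, E[2])`, `H¹_s` at Kolyvagin primes (`Δ_W < 0`), Čebotarev at `M = 2` (`H¹(S₃, E[2]) = 0`), Mazur–Rubin 2010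
Lemmas 2.2 (i)/2.10, and Cassels–Tate parity for `Ш(Wd/ℚ)`.  In print only for odd `p` (Gross 1991 Props. 2.1/2.3 «`p` odd,
`p ∤ D_K`»; Kolyvagin 1990 Cor. 13 carries the `2`-adic error term `d`).  Why it might fail: only through the `p = 2` face of Gross's
Prop. 6.2 (item 24880 at `M = 2`) — every other leaf is a theorem in print valid at `2`.  Census: = AN-28c-U's rows with `Δ < 0`,
`t = 1`, `s = 0`, `m = 0` (ENGINE L j300076 + j303912: no violation among 1020 rows); minimal-door SUPPLY 2180/2180 slice-proxy curves
(kit j309196).  [cite: GrossLMS1991, Props. 2.1, 2.3 and §10] [cite: Kolyvagin1990, Thm. A] [cite: MazurRubin2010, Lemmas 2.2, 2.10] -/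
@[conjecture] def DoorIndexLawUpperCAtTwoBottomNeg : Prop :=
  ∀ (W : WeierstrassCurve ℚ) [W.IsElliptic] [W.IsGloballyMinimal] [NeZero (W.conductorNorm ℤ)],
    ¬ W.HasCM → (∀ n : ℕ, W.HasSurjectiveModNGaloisRep ((2 ^ n : ℕ) : ℤ)) → Odd W.torsionOrder → Odd W.tamagawaProduct →
    W.analyticRank = 1 →
    ∀ (K : Type) [Field K] [NumberField K], IsImaginaryQuadratic K →
      DoorAdmissible W (NumberField.discr K) →
      (W.quadraticTwist (NumberField.discr K : ℚ)).entireLFunction 1 ≠ 0 →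
      ∀ (Dt : ModularParametrizationData W (W.conductorNorm ℤ))
        (H : HeegnerDatum (W.conductorNorm ℤ) (NumberField.discr K)) (ι : K →+* ℂ)
        (P : (W.baseChange K).toAffine.Point),
        WeierstrassCurve.Affine.Point.map ι.toRatAlgHom P = heegnerPointComplex Dt H →
        ∀ (Wd : WeierstrassCurve ℚ) [Wd.IsElliptic] [Wd.IsGloballyMinimal] (Cd : WeierstrassCurve.VariableChange ℚ),
          Cd • W.quadraticTwist (NumberField.discr K : ℚ) = Wd →
          W.Δ < 0 → transpCount W (NumberField.discr K) = 1 → identCount W (NumberField.discr K) = 0 → Odd Dt.c →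
          HasTwoDivisibilityUpToTorsion W K P 0 →
            padicValNat 2 (Nat.card (AddCommGroup.primaryComponent W.sha 2)) +
                padicValNat 2 (Nat.card (AddCommGroup.primaryComponent Wd.sha 2)) +
                transpCount W (NumberField.discr K) + 2 * identCount W (NumberField.discr K) +
                2 * padicValInt 2 Dt.c ≤
              2 * 0 + (if W.Δ < 0 then 1 else 0)

/-- **The complement of the bottom rung inside the Euler-system half (CONJECTURE-GRADE residue).**  `DoorIndexLawUpperCAtTwo` with ONE
extra hypothesis: the datum is NOT in the bottom-rung corner, `¬ (Δ_W < 0 ∧ t = 1 ∧ s = 0 ∧ Odd Dt.c ∧ m = 0)`.  This is where the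
genuinely open content of U lives: `Δ_W > 0` (level-`≥ 4` Kolyvagin primes, index-`2` image of `E(ℚ_ℓ)` in `E(K_λ)`, archimedean error
place — route GenusKolyvaginAtTwo's residual 24883), NON-minimal doors (`t + 2s > [Δ_W < 0]`: there U asserts Heegner `2`-DIVISIBILITY
from genus excess — the `GenusPacketDivisibilityAtTwo` family, no Euler-system statement), `m ≥ 1` (higher layers: inflation `ℤ/2` at
`M ≥ 4`, `R_M`-linear rigidity — item 24882), even constants.  Why it might fail / census: as `DoorIndexLawUpperCAtTwo`.
[cite: Kolyvagin1990, Thm. A] [cite: GrossLMS1991, Conj. 1.2 and §3] -/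
@[conjecture] def DoorIndexLawUpperCAtTwoOffBottomNeg : Prop :=
  ∀ (W : WeierstrassCurve ℚ) [W.IsElliptic] [W.IsGloballyMinimal] [NeZero (W.conductorNorm ℤ)],
    ¬ W.HasCM → (∀ n : ℕ, W.HasSurjectiveModNGaloisRep ((2 ^ n : ℕ) : ℤ)) → Odd W.torsionOrder → Odd W.tamagawaProduct →
    W.analyticRank = 1 →
    ∀ (K : Type) [Field K] [NumberField K], IsImaginaryQuadratic K →
      DoorAdmissible W (NumberField.discr K) →
      (W.quadraticTwist (NumberField.discr K : ℚ)).entireLFunction 1 ≠ 0 →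
      ∀ (Dt : ModularParametrizationData W (W.conductorNorm ℤ))
        (H : HeegnerDatum (W.conductorNorm ℤ) (NumberField.discr K)) (ι : K →+* ℂ)
        (P : (W.baseChange K).toAffine.Point),
        WeierstrassCurve.Affine.Point.map ι.toRatAlgHom P = heegnerPointComplex Dt H →
        ∀ (Wd : WeierstrassCurve ℚ) [Wd.IsElliptic] [Wd.IsGloballyMinimal] (Cd : WeierstrassCurve.VariableChange ℚ),
          Cd • W.quadraticTwist (NumberField.discr K : ℚ) = Wd →
          ∀ m : ℕ, HasTwoDivisibilityUpToTorsion W K P m →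
            ¬ (W.Δ < 0 ∧ transpCount W (NumberField.discr K) = 1 ∧ identCount W (NumberField.discr K) = 0 ∧ Odd Dt.c ∧ m = 0) →
            padicValNat 2 (Nat.card (AddCommGroup.primaryComponent W.sha 2)) +
                padicValNat 2 (Nat.card (AddCommGroup.primaryComponent Wd.sha 2)) +
                transpCount W (NumberField.discr K) + 2 * identCount W (NumberField.discr K) +
                2 * padicValInt 2 Dt.c ≤
              2 * m + (if W.Δ < 0 then 1 else 0)

/-- **Reading of U₀⁻'s conclusion**: under `Δ_W < 0`, `t = 1`, `s = 0` and `Odd Dt.c` the door inequality at `m = 0` says exactly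
`ord₂ #Ш(W)[2^∞] = 0 ∧ ord₂ #Ш(Wd)[2^∞] = 0` (import-free arithmetic: `v₂(c) = 0` for odd `c`). [cite: GrossLMS1991, Prop. 2.1] -/
theorem bottomNeg_conclusion_iff (W : WeierstrassCurve ℚ) [W.IsGloballyMinimal] (d : ℤ) (c : ℤ) (sW sd : ℕ)
    (hΔ : W.Δ < 0) (ht : transpCount W d = 1) (hs : identCount W d = 0) (hc : Odd c) :
    sW + sd + transpCount W d + 2 * identCount W d + 2 * padicValInt 2 c ≤ 2 * 0 + (if W.Δ < 0 then 1 else 0) ↔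
      sW = 0 ∧ sd = 0 := by
  have hc2 : ¬ (2 : ℤ) ∣ c := fun h => Int.not_even_iff_odd.mpr hc (even_iff_two_dvd.mpr h)
  rw [if_pos hΔ, ht, hs, padicValInt.eq_zero_of_not_dvd hc2]
  omega

/-- **U ⇒ U₀⁻** (the bottom rung is an instance of the Euler-system half: `m := 0`). [cite: Kolyvagin1990, Thm. A] -/
theorem doorIndexLawUpperCAtTwoBottomNeg_of_doorIndexLawUpperCAtTwo (h : DoorIndexLawUpperCAtTwo) :
    DoorIndexLawUpperCAtTwoBottomNeg := by
  intro W _ _ _ hCM hsurj hT hc hr K _ _ hK hadm hLt Dt H ι P hP Wd _ _ Cd hWd _hΔ _ht _hs _hodd hm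
  exact h W hCM hsurj hT hc hr K hK hadm hLt Dt H ι P hP Wd Cd hWd 0 hm

/-- **U ⇒ its off-corner part** (drop the extra hypothesis). [cite: Kolyvagin1990, Thm. A] -/
theorem doorIndexLawUpperCAtTwoOffBottomNeg_of_doorIndexLawUpperCAtTwo (h : DoorIndexLawUpperCAtTwo) :
    DoorIndexLawUpperCAtTwoOffBottomNeg := by
  intro W _ _ _ hCM hsurj hT hc hr K _ _ hK hadm hLt Dt H ι P hP Wd _ _ Cd hWd m hm _hoff
  exact h W hCM hsurj hT hc hr K hK hadm hLt Dt H ι P hP Wd Cd hWd m hm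

/-- **U₀⁻ ∧ (U off the corner) ⇒ U** — the reshape of `stub_doorUpperC` into two stubs is LOSSLESS (case split on the corner).
[cite: Kolyvagin1990, Thm. A] -/
theorem doorIndexLawUpperCAtTwo_of_bottomNeg_of_offBottomNeg (h0 : DoorIndexLawUpperCAtTwoBottomNeg)
    (h1 : DoorIndexLawUpperCAtTwoOffBottomNeg) : DoorIndexLawUpperCAtTwo := by
  intro W _ _ _ hCM hsurj hT hc hr K _ _ hK hadm hLt Dt H ι P hP Wd _ _ Cd hWd m hm
  by_cases hcorner : W.Δ < 0 ∧ transpCount W (NumberField.discr K) = 1 ∧ identCount W (NumberField.discr K) = 0 ∧ Odd Dt.c ∧ m = 0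
  · obtain ⟨hΔ, ht, hs, hodd, rfl⟩ := hcorner
    exact h0 W hCM hsurj hT hc hr K hK hadm hLt Dt H ι P hP Wd Cd hWd hΔ ht hs hodd hm
  · exact h1 W hCM hsurj hT hc hr K hK hadm hLt Dt H ι P hP Wd Cd hWd m hm hcorner

/-- **U ⟺ U₀⁻ ∧ (U off the corner)** — bookkeeping for the skeleton v8.7 and the pen. [cite: Kolyvagin1990, Thm. A] -/
theorem doorIndexLawUpperCAtTwo_iff_bottomNeg_and_offBottomNeg :
    DoorIndexLawUpperCAtTwo ↔ DoorIndexLawUpperCAtTwoBottomNeg ∧ DoorIndexLawUpperCAtTwoOffBottomNeg :=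
  ⟨fun h => ⟨doorIndexLawUpperCAtTwoBottomNeg_of_doorIndexLawUpperCAtTwo h,
    doorIndexLawUpperCAtTwoOffBottomNeg_of_doorIndexLawUpperCAtTwo h⟩,
    fun h => doorIndexLawUpperCAtTwo_of_bottomNeg_of_offBottomNeg h.1 h.2⟩


/-! ### APPEND #7b (lead prover seat `bsd-line-fkl-p1` g11, 2026-08-28T14:4xZ) — LINE v8.8: the bottom rung SIGN-FREE

The abstract engine `Theorems/…OneDoorFirstDescentAtTwo.lean` (p637958) has an ABSTRACT error place `q₀`; nothing in its six theorems uses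
`Δ_W < 0`.  What the sign of `Δ_W` changes is (a) WHERE the single error place of a minimal door sits — the one transposition prime `q₀ ∣ d_K`
when `Δ_W < 0` (`t = 1`, `s = 0`), the REAL place when `Δ_W > 0` (`t = s = 0`; Kramer's local norm index at `∞` is `ℤ/2` exactly when
`Δ_W > 0`, and `E(ℝ)/2E(ℝ) ≅ E^K(ℝ)/2E^K(ℝ) ≅ ℤ/2` are the two one-line conditions there) — and (b) WHICH Kolyvagin primes feed the
descent: at `M = 2` the Euler-system congruences `2 ∣ ℓ + 1`, `2 ∣ a_ℓ` hold for every inert good `ℓ` whose Frobenius on `E[2]` is the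
identity OR a transposition; Gross's choice `Frob_ℓ = Frob_∞` gives transpositions when `Δ_W < 0` but the identity when `Δ_W > 0`
(where the first layer is vacuous: every rational point is `2`-divisible in `E(K_λ)`), whereas the «regular» primes of MEMO-es §18
(`Frob_ℓ` a transposition on `E[2]`, `ℓ` inert in `K` — a Čebotarev class of `Gal(K(E[2])/ℚ) ≅ S₃ × C₂` for either sign) give
`H¹(K_λ/ℚ_ℓ, E[2]) = 0` and one-line `H¹_ur(ℚ_ℓ, E[2])` for either sign.  Hence ONE sign-free bottom rung, `DoorIndexLawUpperCAtTwoBottom`: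
minimal door `t + 2s + [Δ_W > 0] = 1`, odd constant, `m = 0` ⟹ `Ш(W)[2] = Ш(Wd)[2] = 0` — the union of U₀⁻ (above) and -es's U₀⁺
(`HeegnerCornerPosDiscAtTwo`, MEMO-es §18.11–18.12) — with the same kernel engine and the same leaf list (Gross 6.2 (1)(2) at `2` for the
first layer at regular primes; Poitou–Tate, Čebotarev at `M = 2`, Cassels–Tate parity, MR10 Lemmas 2.2/2.9/2.10, Kramer Prop. 6 at `∞`).
Import-free bookkeeping: U ⟺ Bottom ∧ OffBottom (lossless), Bottom ⟹ BottomNeg.  Nothing is asserted; BSD is not proved by any of this. -/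

/-- **U₀ `DoorIndexLawUpperCAtTwoBottom` — the BOTTOM RUNG of the Euler-system half, SIGN-FREE (THEOREM-CANDIDATE; tagged `conjecture`
only because it is unproved in the tree).**  Binders VERBATIM as in `DoorIndexLawUpperCAtTwo`, the exponent specialised to `m = 0`, and TWO
extra hypotheses: the door is MINIMAL — exactly one error place, `t + 2s = [Δ_W < 0]` (one transposition prime and no identity prime when
`Δ_W < 0`; only 3-cycle primes, the error place being `∞`, when `Δ_W > 0`) — and `Dt.c` is odd.  THEN `P ∉ 2E(K) + E(K)_tors` forces
`ord₂ #Ш(W)[2^∞] = 0 ∧ ord₂ #Ш(Wd)[2^∞] = 0` (`bottom_conclusion_iff`).  Proof ON PAPER: Kolyvagin's first `2`-descent over `ℚ` with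
REGULAR Kolyvagin primes (`Frob_ℓ` a transposition on `E[2]`) and the single error place (`q₀` resp. `∞`) — kernel engine
`Theorems/…OneDoorFirstDescentAtTwo.lean`; `Δ_W < 0` corner = U₀⁻ (lead reports G10 §3 / G11 §2), `Δ_W > 0` corner = U₀⁺ (MEMO-es §18.11–12).
Why it might fail: only through the `p = 2`, first-layer, regular-prime face of Gross's Prop. 6.2 (route GenusKolyvaginAtTwo item 24880 at
`M = 2`); every other leaf is a tree theorem or print valid at `2`.  Census (G11 §6, -an certified tables): `Δ < 0` corner 812/812 direct +
370/370 contrapositive; minimal-door supply 2180/2180 (kit j309196, both signs).  [cite: GrossLMS1991, Props. 2.1, 2.3, 6.2 and §10]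
[cite: Kolyvagin1990, Thm. A] [cite: MazurRubin2010, Lemmas 2.2, 2.9, 2.10] [cite: Kramer1981, Prop. 6] -/
@[conjecture] def DoorIndexLawUpperCAtTwoBottom : Prop :=
  ∀ (W : WeierstrassCurve ℚ) [W.IsElliptic] [W.IsGloballyMinimal] [NeZero (W.conductorNorm ℤ)],
    ¬ W.HasCM → (∀ n : ℕ, W.HasSurjectiveModNGaloisRep ((2 ^ n : ℕ) : ℤ)) → Odd W.torsionOrder → Odd W.tamagawaProduct →
    W.analyticRank = 1 →
    ∀ (K : Type) [Field K] [NumberField K], IsImaginaryQuadratic K →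
      DoorAdmissible W (NumberField.discr K) →
      (W.quadraticTwist (NumberField.discr K : ℚ)).entireLFunction 1 ≠ 0 →
      ∀ (Dt : ModularParametrizationData W (W.conductorNorm ℤ))
        (H : HeegnerDatum (W.conductorNorm ℤ) (NumberField.discr K)) (ι : K →+* ℂ)
        (P : (W.baseChange K).toAffine.Point),
        WeierstrassCurve.Affine.Point.map ι.toRatAlgHom P = heegnerPointComplex Dt H →
        ∀ (Wd : WeierstrassCurve ℚ) [Wd.IsElliptic] [Wd.IsGloballyMinimal] (Cd : WeierstrassCurve.VariableChange ℚ),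
          Cd • W.quadraticTwist (NumberField.discr K : ℚ) = Wd →
          transpCount W (NumberField.discr K) + 2 * identCount W (NumberField.discr K) = (if W.Δ < 0 then 1 else 0) → Odd Dt.c →
          HasTwoDivisibilityUpToTorsion W K P 0 →
            padicValNat 2 (Nat.card (AddCommGroup.primaryComponent W.sha 2)) +
                padicValNat 2 (Nat.card (AddCommGroup.primaryComponent Wd.sha 2)) +
                transpCount W (NumberField.discr K) + 2 * identCount W (NumberField.discr K) +
                2 * padicValInt 2 Dt.c ≤
              2 * 0 + (if W.Δ < 0 then 1 else 0)

/-- **The complement of the sign-free bottom rung inside the Euler-system half (CONJECTURE-GRADE residue).**  `DoorIndexLawUpperCAtTwo` with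
ONE extra hypothesis: the datum is NOT in the bottom corner, `¬ (t + 2s = [Δ_W < 0] ∧ Odd Dt.c ∧ m = 0)` — NON-minimal doors (there U asserts
Heegner `2`-DIVISIBILITY from the excess error places: genus-divisibility / `GenusPacketDivisibilityAtTwo` family, no Euler-system statement),
`m ≥ 1` (higher layers: inflation `ℤ/2` at `M ≥ 4`, `R_M`-linear rigidity — item 24882; level-`≥ 2` regular primes vs Kummer entanglement —
MEMO-es §18), even constants.  Why it might fail / census: as `DoorIndexLawUpperCAtTwo`. [cite: Kolyvagin1990, Thm. A] [cite: GrossLMS1991, Conj. 1.2 and §3] -/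
@[conjecture] def DoorIndexLawUpperCAtTwoOffBottom : Prop :=
  ∀ (W : WeierstrassCurve ℚ) [W.IsElliptic] [W.IsGloballyMinimal] [NeZero (W.conductorNorm ℤ)],
    ¬ W.HasCM → (∀ n : ℕ, W.HasSurjectiveModNGaloisRep ((2 ^ n : ℕ) : ℤ)) → Odd W.torsionOrder → Odd W.tamagawaProduct →
    W.analyticRank = 1 →
    ∀ (K : Type) [Field K] [NumberField K], IsImaginaryQuadratic K →
      DoorAdmissible W (NumberField.discr K) →
      (W.quadraticTwist (NumberField.discr K : ℚ)).entireLFunction 1 ≠ 0 →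
      ∀ (Dt : ModularParametrizationData W (W.conductorNorm ℤ))
        (H : HeegnerDatum (W.conductorNorm ℤ) (NumberField.discr K)) (ι : K →+* ℂ)
        (P : (W.baseChange K).toAffine.Point),
        WeierstrassCurve.Affine.Point.map ι.toRatAlgHom P = heegnerPointComplex Dt H →
        ∀ (Wd : WeierstrassCurve ℚ) [Wd.IsElliptic] [Wd.IsGloballyMinimal] (Cd : WeierstrassCurve.VariableChange ℚ),
          Cd • W.quadraticTwist (NumberField.discr K : ℚ) = Wd →
          ∀ m : ℕ, HasTwoDivisibilityUpToTorsion W K P m →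
            ¬ (transpCount W (NumberField.discr K) + 2 * identCount W (NumberField.discr K) = (if W.Δ < 0 then 1 else 0) ∧
                Odd Dt.c ∧ m = 0) →
            padicValNat 2 (Nat.card (AddCommGroup.primaryComponent W.sha 2)) +
                padicValNat 2 (Nat.card (AddCommGroup.primaryComponent Wd.sha 2)) +
                transpCount W (NumberField.discr K) + 2 * identCount W (NumberField.discr K) +
                2 * padicValInt 2 Dt.c ≤
              2 * m + (if W.Δ < 0 then 1 else 0)

/-- **Reading of U₀'s conclusion**: under `t + 2s = [Δ_W < 0]` and `Odd Dt.c` the door inequality at `m = 0` says exactly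
`ord₂ #Ш(W)[2^∞] = 0 ∧ ord₂ #Ш(Wd)[2^∞] = 0` (import-free arithmetic). [cite: GrossLMS1991, Prop. 2.1] -/
theorem bottom_conclusion_iff (W : WeierstrassCurve ℚ) [W.IsGloballyMinimal] (d : ℤ) (c : ℤ) (sW sd : ℕ)
    (hmin : transpCount W d + 2 * identCount W d = (if W.Δ < 0 then 1 else 0)) (hc : Odd c) :
    sW + sd + transpCount W d + 2 * identCount W d + 2 * padicValInt 2 c ≤ 2 * 0 + (if W.Δ < 0 then 1 else 0) ↔
      sW = 0 ∧ sd = 0 := by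
  have hc2 : ¬ (2 : ℤ) ∣ c := fun h => Int.not_even_iff_odd.mpr hc (even_iff_two_dvd.mpr h)
  rw [padicValInt.eq_zero_of_not_dvd hc2]
  by_cases hΔ : W.Δ < 0
  · rw [if_pos hΔ] at hmin ⊢; omega
  · rw [if_neg hΔ] at hmin ⊢; omega

/-- At negative discriminant the minimal-door condition `t + 2s = [Δ<0]` is `t = 1 ∧ s = 0`. [folklore] -/
theorem minimal_iff_of_neg (W : WeierstrassCurve ℚ) [W.IsGloballyMinimal] (d : ℤ) (hΔ : W.Δ < 0) :
    transpCount W d + 2 * identCount W d = (if W.Δ < 0 then 1 else 0) ↔ transpCount W d = 1 ∧ identCount W d = 0 := by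
  rw [if_pos hΔ]
  omega

/-- **U₀ ⟹ U₀⁻** (the sign-free bottom rung specialises to the negative-discriminant one). [cite: GrossLMS1991, Prop. 2.1] -/
theorem doorIndexLawUpperCAtTwoBottomNeg_of_bottom (h : DoorIndexLawUpperCAtTwoBottom) : DoorIndexLawUpperCAtTwoBottomNeg := by
  intro W _ _ _ hCM hsurj hT hc hr K _ _ hK hadm hLt Dt H ι P hP Wd _ _ Cd hWd hΔ ht hs hodd hm
  exact h W hCM hsurj hT hc hr K hK hadm hLt Dt H ι P hP Wd Cd hWd ((minimal_iff_of_neg W _ hΔ).mpr ⟨ht, hs⟩) hodd hm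

/-- **U ⟹ U₀** (instance `m := 0`). [cite: Kolyvagin1990, Thm. A] -/
theorem doorIndexLawUpperCAtTwoBottom_of_doorIndexLawUpperCAtTwo (h : DoorIndexLawUpperCAtTwo) : DoorIndexLawUpperCAtTwoBottom := by
  intro W _ _ _ hCM hsurj hT hc hr K _ _ hK hadm hLt Dt H ι P hP Wd _ _ Cd hWd _hmin _hodd hm
  exact h W hCM hsurj hT hc hr K hK hadm hLt Dt H ι P hP Wd Cd hWd 0 hm

/-- **U ⟹ its off-bottom part** (drop the extra hypothesis). [cite: Kolyvagin1990, Thm. A] -/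
theorem doorIndexLawUpperCAtTwoOffBottom_of_doorIndexLawUpperCAtTwo (h : DoorIndexLawUpperCAtTwo) :
    DoorIndexLawUpperCAtTwoOffBottom := by
  intro W _ _ _ hCM hsurj hT hc hr K _ _ hK hadm hLt Dt H ι P hP Wd _ _ Cd hWd m hm _hoff
  exact h W hCM hsurj hT hc hr K hK hadm hLt Dt H ι P hP Wd Cd hWd m hm

/-- **U₀ ∧ (U off the bottom) ⟹ U** — the reshape of `stub_doorUpperC` into `stub_doorUpperBottom` + `stub_doorUpperOffBottom` is LOSSLESS.
[cite: Kolyvagin1990, Thm. A] -/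
theorem doorIndexLawUpperCAtTwo_of_bottom_of_offBottom (h0 : DoorIndexLawUpperCAtTwoBottom) (h1 : DoorIndexLawUpperCAtTwoOffBottom) :
    DoorIndexLawUpperCAtTwo := by
  intro W _ _ _ hCM hsurj hT hc hr K _ _ hK hadm hLt Dt H ι P hP Wd _ _ Cd hWd m hm
  by_cases hcorner : transpCount W (NumberField.discr K) + 2 * identCount W (NumberField.discr K) = (if W.Δ < 0 then 1 else 0) ∧
      Odd Dt.c ∧ m = 0
  · obtain ⟨hmin, hodd, rfl⟩ := hcorner
    exact h0 W hCM hsurj hT hc hr K hK hadm hLt Dt H ι P hP Wd Cd hWd hmin hodd hm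
  · exact h1 W hCM hsurj hT hc hr K hK hadm hLt Dt H ι P hP Wd Cd hWd m hm hcorner

/-- **U ⟺ U₀ ∧ (U off the bottom)** — bookkeeping for the skeleton v8.8 and the pen. [cite: Kolyvagin1990, Thm. A] -/
theorem doorIndexLawUpperCAtTwo_iff_bottom_and_offBottom :
    DoorIndexLawUpperCAtTwo ↔ DoorIndexLawUpperCAtTwoBottom ∧ DoorIndexLawUpperCAtTwoOffBottom :=
  ⟨fun h => ⟨doorIndexLawUpperCAtTwoBottom_of_doorIndexLawUpperCAtTwo h, doorIndexLawUpperCAtTwoOffBottom_of_doorIndexLawUpperCAtTwo h⟩,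
    fun h => doorIndexLawUpperCAtTwo_of_bottom_of_offBottom h.1 h.2⟩

end Summit.BirchSwinnertonDyer.BirchSwinnertonDyer.Theorems.RankOneAtTwoOneDoor

end
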